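import Literature.MathematicalPhysics.QuantumLattice.MerminWagnerPeriodicEquilibriumStates
import Literature.MathematicalPhysics.QuantumLattice.InfVolFermionStateGaugeCommutator
import HarnessLib

/-!
# States satisfying the Bogoliubov rows: Bogoliubov's inequality, stability under limits, and the Mermin–Wagner theorem
# for EVERY such state in two dimensions (Klein–Landau–Shucker for lattice fermions, no homogeneity assumption)

Topic `Literature/MathematicalPhysics/QuantumLattice` (family `hubbard`). The tree proves the Mermin–Wagner theorem of
Klein–Landau–Shucker [cite: KleinLandauShucker1981] twice, for two classes of equilibrium states each of which is SHOWN to satisfy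
Bogoliubov's inequality: translation-invariant solutions of the variational principle (`MerminWagnerCriterionEquilibriumStates`,
`MerminWagnerEquilibriumStates2D`, `HubbardTTPrimeEquilibriumStatesNoPairing`, fed by `VariationalPrincipleBogoliubovInequality`) and
`q`-periodic equilibrium states (`MerminWagnerPeriodicEquilibriumStates`, fed by `PeriodicEquilibriumStatesPerturbationRows`). The
argument itself uses nothing about the state except the **Bogoliubov rows** — the linear form

  `0 ≤ Re ω(ÃÃᴴ + ÃᴴÃ) + 2 Re ω(C̃Ã − ÃC̃) + ½β Re ω(C̃ᴴ(H_{Λ'}C̃ − C̃H_{Λ'}) − (H_{Λ'}C̃ − C̃H_{Λ'})C̃ᴴ)`   (all local `A, C ∈ 𝔄_Λ`,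
  all windows `Λ' ⊇ thicken Λ R`; `Ã, C̃` the embeddings into `𝔄_{Λ'}`, `H_{Λ'}` the local Hamiltonian of `Ψ`)

of Bogoliubov's inequality `|ω([C̃, Ã])|² ≤ ½β · ω({Ã, Ãᴴ}) · ω([C̃ᴴ, [H_{Λ'}, C̃]])` [cite: DLS1978, §2 eq. (28)], an exact
constraint on every `β`-KMS state which is LINEAR in the state (Fawzi–Fawzi–Scalet's row family) and hence survives weak⋆ limits
and limits of the interaction. This file isolates that hypothesis as a predicate and proves the theorem once for all of them:

* §1 `InfVolFermionState.HasBogoliubovRows ω Ψ R β` (DEFINITION, the displayed rows); Bogoliubov's inequality from the rows by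
  optimising over `A ↦ μA` (`HasBogoliubovRows.bogoliubov_inequality`); the rows are CLOSED under local (weak⋆) limits of states
  jointly with limits `β_k → β` and limits `Ψ₀ + s_kΨ₁`, `s_k → s` along a pencil of interactions
  (`HasBogoliubovRows.of_tendsto_pencil`, `….of_tendsto`) — the form in which symmetry-breaking sources are switched off
  [cite: KomaTasaki1993, §1 (1.8)] [cite: BratteliRobinsonII1997, Prop. 5.3.25]; the tree's two classes satisfy the predicate
  (`IsTranslationInvariant.hasBogoliubovRows_of_variationalPrinciple`, `IsVarEquilibrium.hasBogoliubovRows`,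
  `IsPerVarEquilibrium.hasBogoliubovRows`).
* §2 the Klein–Landau–Shucker criterion for a state with Bogoliubov rows (`HasBogoliubovRows.norm_sq_expect_le_of_double_commutator`,
  `….expect_eq_zero_of_small_double_commutators`) and its form for a conserved even Hermitian on-site charge
  (`….norm_sq_expect_le_of_conservedCharge`, `….expect_eq_zero_of_conservedCharge`): `|κ|²|ω(O)|² ≤ β‖O‖² · 4‖q‖² Σ_Z ‖Φ(Z)‖(Σ_{x∈Z}|f(x) − c_Z|)²`.
* §3 **two dimensions**: for `Ψ` translation covariant of finite range `R` on `ℤ²` whose terms conserve `q`, every `β ≥ 0` and EVERY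
  state `ω` with the Bogoliubov rows of `Ψ` at `β` — translation invariant or not, periodic or not, extremal or not —
  `ω(O) = 0` for every local `O` of nonzero charge (`HasBogoliubovRows.expect_eq_zero_of_conservedCharge_two`). This is the printed
  generality of Klein–Landau–Shucker's theorem («every KMS state», no homogeneity), modulo the identification KMS ⟹ rows which the
  tree proves class by class.
* §4 the 2D `t–t'` Hubbard model `gcInteractionTT' t t' U μ h`: a state with its Bogoliubov rows at `β ≥ 0` annihilates every local
  observable of nonzero particle number (`….expect_eq_zero_of_numberCharged_ttPrime`) or spin imbalance (`…_spinCharged_ttPrime`),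
  every pair amplitude `ω(c_p c_q)` (`….expect_annihilation_mul_annihilation_eq_zero_ttPrime`), every local singlet-pair amplitude
  `ω(P_x)` (`….expect_localPairAt_eq_zero_ttPrime`), and IS GAUGE INVARIANT (`….isGaugeInvariant_ttPrime`: `ω([N̂_Λ, A]) = 0` for all
  local `A` by decomposing `A` into charged matrix units, `isGaugeInvariant_of_forall_expect_commutator`).

The consumer this was written for: Koma–Tasaki's infinitesimal-pair-field thermal states of the 2D `t–t'` Hubbard model
(`HubbardInfinitesimalPairFieldThermalStates`), limits `h ↓ 0` of torus limits of pair-sourced Gibbs states, which inherit the rows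
(`DWaveSourceThermalStatesBogoliubovRows` + §1) but are not known to solve the variational principle. Everything except the one
definition is PROVED (standard axioms); no named fact, no sorry.

## Mathlib / tree search

`lean search 'HasBogoliubovRows|BogoliubovState|of_bogoliubovRows'` (2026-08-29): nothing. REUSED verbatim (state-independent):
`weightedCharge`, `weightedCharge_commutator_fermionEmbed`, `fermionEmbed_incl_weightedCharge`, `conjTranspose_weightedCharge`,
`norm_doubleCommutator_weightedCharge_localHamiltonian_le`, `FermionInteraction.sum_norm_mul_sq_sum_le`, `fermionEmbed_incl_fermionEmbed_incl`
(`MerminWagnerCriterionEquilibriumStates`); `exists_logCutoff_data` (`MerminWagnerEquilibriumStates2D`); `numberCharge`, `spinCharge`,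
`chargeSum_numberCharge/spinCharge`, `commute_chargeSum_numberCharge/spinCharge_gcInteractionTT'`, `totalNumber_commutator_annihilation_mul_annihilation`
(`HubbardTTPrimeEquilibriumStatesNoPairing`, `HubbardTTPrimeCanonicalStatesChargedRows`); `IsTranslationInvariant.bogoliubovRow_nonneg_of_variationalPrinciple`,
`IsVarEquilibrium.bogoliubovRow_nonneg` (`VariationalPrincipleBogoliubovInequality`, whose `μA`-optimisation §1 follows);
`IsPerVarEquilibrium.bogoliubovRow_nonneg` (`PeriodicEquilibriumStatesPerturbationRows`); `FermionInteraction.pencil`, `localHamiltonian_pencil`,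
`pencil_zero_apply`, `FermionInteraction.ext`; `isGaugeInvariant_of_forall_expect_commutator`, `hasGaugeCharge_iff_commutator`,
`hasGaugeCharge_single`, `totalNumberOp_eq_totalNumber`, `hasGaugeCharge_localPairAt` (`InfVolFermionStateGaugeCommutator`, `…GaugeAction`,
`FockGaugeAction`).

## References

* A. Klein, L. J. Landau, D. S. Shucker, *On the absence of spontaneous breakdown of continuous symmetry for equilibrium states in two
  dimensions*, J. Stat. Phys. 26 (1981) 505–512, Theorem (every KMS state; Bogoliubov inequality + logarithmic cutoff).
  [cite: KleinLandauShucker1981]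
* F. J. Dyson, E. H. Lieb, B. Simon, J. Stat. Phys. 18 (1978) 335, §2 eq. (28) (Bogoliubov's inequality). [cite: DLS1978, §2 eq. (28)]
* H. Araki, H. Moriya, Rev. Math. Phys. 15 (2003) 93, Thm. 12.11 (absence of continuous symmetry breaking, lattice fermions, `ν ≤ 2`).
  [cite: ArakiMoriya2003, Theorem 12.11]
* T. Koma, H. Tasaki, Commun. Math. Phys. 158 (1993) 191, §1 (1.8) (states under an infinitesimal field). [cite: KomaTasaki1993, §1 (1.8)]
* T. Koma, H. Tasaki, Phys. Rev. Lett. 68 (1992) 3248 (no pairing / planar magnetic order in 1D/2D Hubbard models at `T > 0`).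
  [cite: KomaTasakiPRL1992, p. 3]
* O. Bratteli, D. W. Robinson, *Operator Algebras and Quantum Statistical Mechanics 2*, 2nd ed. (1997), Prop. 5.3.25 (limits of KMS
  states under convergent perturbations), §5.2.2 (gauge group). [cite: BratteliRobinsonII1997, Prop. 5.3.25]
* H. Fawzi, O. Fawzi, S. O. Scalet, Nat. Commun. 15 (2024) 7394, Thm. 3.1 (KMS constraints linear in the state).
  [cite: FawziFawziScalet2024, Thm. 3.1]
-/

noncomputable section

open scoped ComplexOrder BigOperators Matrix.Norms.L2Operator
open Finset Literature.InformationTheory.Entropy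

namespace Literature.MathematicalPhysics.QuantumLattice

open Matrix Literature.Probability.LatticeModels ThermodynamicLimit
open _root_.Filter
open scoped _root_.Topology

variable {d : ℕ}

namespace InfVolFermionState

/-! ### §1 The Bogoliubov rows of a state: definition, Bogoliubov's inequality, stability under limits, the known classes -/

section Definition

/-- **A state satisfying the Bogoliubov rows of `Ψ` (range parameter `R`) at inverse temperature `β`.** For all finite `Λ ⊆ Λ'`
with `thicken Λ R ⊆ Λ'` and all `A, C ∈ 𝔄_Λ`, with `Ã = Γ_{Λ⊆Λ'}A`, `C̃ = Γ_{Λ⊆Λ'}C` and `H_{Λ'} = Ψ.localHamiltonian Λ'`: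

  `0 ≤ Re ω_{Λ'}(ÃÃᴴ + ÃᴴÃ) + 2 Re ω_{Λ'}(C̃Ã − ÃC̃) + ½β Re ω_{Λ'}(C̃ᴴ(H_{Λ'}C̃ − C̃H_{Λ'}) − (H_{Λ'}C̃ − C̃H_{Λ'})C̃ᴴ)`

— the linear ("row") form of Bogoliubov's inequality `|ω([C̃, Ã])|² ≤ ½β ω({Ã, Ãᴴ}) ω([C̃ᴴ,[H_{Λ'},C̃]])` of a `β`-KMS state
(the inequality is recovered by optimising over `A ↦ μA`, `HasBogoliubovRows.bogoliubov_inequality`; the window condition makes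
`[H_{Λ'}, C̃]` the full derivation of `C` when `Ψ` has range `R`). [cite: DLS1978, §2 eq. (28)] [cite: KleinLandauShucker1981]
[cite: FawziFawziScalet2024, Thm. 3.1] -/
def HasBogoliubovRows (ω : InfVolFermionState d) (Ψ : FermionInteraction d) (R β : ℝ) : Prop :=
  ∀ ⦃Λ Λ' : Finset (Site d)⦄ (hΛ : Λ ⊆ Λ') (_ : thicken Λ R ⊆ Λ') (A C : FermionOp Λ),
    0 ≤ (ω.expect Λ' (fermionEmbed (PolySite.incl hΛ) A * (fermionEmbed (PolySite.incl hΛ) A)ᴴ +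
          (fermionEmbed (PolySite.incl hΛ) A)ᴴ * fermionEmbed (PolySite.incl hΛ) A)).re +
      2 * (ω.expect Λ' (fermionEmbed (PolySite.incl hΛ) C * fermionEmbed (PolySite.incl hΛ) A -
          fermionEmbed (PolySite.incl hΛ) A * fermionEmbed (PolySite.incl hΛ) C)).re +
      β / 2 * (ω.expect Λ' ((fermionEmbed (PolySite.incl hΛ) C)ᴴ *
            (Ψ.localHamiltonian Λ' * fermionEmbed (PolySite.incl hΛ) C -
              fermionEmbed (PolySite.incl hΛ) C * Ψ.localHamiltonian Λ') -
          (Ψ.localHamiltonian Λ' * fermionEmbed (PolySite.incl hΛ) C -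
              fermionEmbed (PolySite.incl hΛ) C * Ψ.localHamiltonian Λ') *
            (fermionEmbed (PolySite.incl hΛ) C)ᴴ)).re

variable {ω : InfVolFermionState d} {Ψ : FermionInteraction d} {R β : ℝ}

/-- Unfolding lemma. [cite: DLS1978, §2 eq. (28)] -/
theorem hasBogoliubovRows_iff : ω.HasBogoliubovRows Ψ R β ↔
    ∀ ⦃Λ Λ' : Finset (Site d)⦄ (hΛ : Λ ⊆ Λ') (_ : thicken Λ R ⊆ Λ') (A C : FermionOp Λ),
      0 ≤ (ω.expect Λ' (fermionEmbed (PolySite.incl hΛ) A * (fermionEmbed (PolySite.incl hΛ) A)ᴴ +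
            (fermionEmbed (PolySite.incl hΛ) A)ᴴ * fermionEmbed (PolySite.incl hΛ) A)).re +
        2 * (ω.expect Λ' (fermionEmbed (PolySite.incl hΛ) C * fermionEmbed (PolySite.incl hΛ) A -
            fermionEmbed (PolySite.incl hΛ) A * fermionEmbed (PolySite.incl hΛ) C)).re +
        β / 2 * (ω.expect Λ' ((fermionEmbed (PolySite.incl hΛ) C)ᴴ *
              (Ψ.localHamiltonian Λ' * fermionEmbed (PolySite.incl hΛ) C -
                fermionEmbed (PolySite.incl hΛ) C * Ψ.localHamiltonian Λ') -
            (Ψ.localHamiltonian Λ' * fermionEmbed (PolySite.incl hΛ) C -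
                fermionEmbed (PolySite.incl hΛ) C * Ψ.localHamiltonian Λ') *
              (fermionEmbed (PolySite.incl hΛ) C)ᴴ)).re :=
  Iff.rfl

/-- **The double-commutator term of a state with Bogoliubov rows is nonnegative**: `0 ≤ ½β Re ω(C̃ᴴ[H_{Λ'},C̃] − [H_{Λ'},C̃]C̃ᴴ)`
(the row at `A = 0`). [cite: DLS1978, §2 eq. (28)] -/
theorem HasBogoliubovRows.double_commutator_nonneg (h : ω.HasBogoliubovRows Ψ R β) {Λ Λ' : Finset (Site d)} (hΛ : Λ ⊆ Λ')
    (h8 : thicken Λ R ⊆ Λ') (C : FermionOp Λ) :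
    0 ≤ β / 2 * (ω.expect Λ' ((fermionEmbed (PolySite.incl hΛ) C)ᴴ *
            (Ψ.localHamiltonian Λ' * fermionEmbed (PolySite.incl hΛ) C -
              fermionEmbed (PolySite.incl hΛ) C * Ψ.localHamiltonian Λ') -
          (Ψ.localHamiltonian Λ' * fermionEmbed (PolySite.incl hΛ) C -
              fermionEmbed (PolySite.incl hΛ) C * Ψ.localHamiltonian Λ') *
            (fermionEmbed (PolySite.incl hΛ) C)ᴴ)).re := by
  have h0 := h hΛ h8 0 C
  simpa only [map_zero, conjTranspose_zero, Matrix.mul_zero, Matrix.zero_mul, add_zero, sub_zero, Complex.zero_re, mul_zero,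
    zero_add] using h0

/-- **BOGOLIUBOV'S INEQUALITY FROM THE ROWS** (Dyson–Lieb–Simon (28) in infinite volume):
`‖ω(C̃Ã − ÃC̃)‖² ≤ ½β · Re ω(ÃÃᴴ + ÃᴴÃ) · Re ω(C̃ᴴ[H_{Λ'},C̃] − [H_{Λ'},C̃]C̃ᴴ)` for all local `A, C ∈ 𝔄_Λ` and every window
`Λ' ⊇ thicken Λ R` — the rows for `A ↦ μA`, `μ ∈ ℂ`, are a nonnegative real quadratic in `μ`, whose discriminant is nonpositive.
[cite: DLS1978, §2 eq. (28)] [cite: KleinLandauShucker1981] -/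
theorem HasBogoliubovRows.bogoliubov_inequality (h : ω.HasBogoliubovRows Ψ R β) {Λ Λ' : Finset (Site d)} (hΛ : Λ ⊆ Λ')
    (h8 : thicken Λ R ⊆ Λ') (A C : FermionOp Λ) :
    ‖ω.expect Λ' (fermionEmbed (PolySite.incl hΛ) C * fermionEmbed (PolySite.incl hΛ) A -
        fermionEmbed (PolySite.incl hΛ) A * fermionEmbed (PolySite.incl hΛ) C)‖ ^ 2 ≤
      β / 2 * (ω.expect Λ' (fermionEmbed (PolySite.incl hΛ) A * (fermionEmbed (PolySite.incl hΛ) A)ᴴ +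
          (fermionEmbed (PolySite.incl hΛ) A)ᴴ * fermionEmbed (PolySite.incl hΛ) A)).re *
        (ω.expect Λ' ((fermionEmbed (PolySite.incl hΛ) C)ᴴ *
            (Ψ.localHamiltonian Λ' * fermionEmbed (PolySite.incl hΛ) C -
              fermionEmbed (PolySite.incl hΛ) C * Ψ.localHamiltonian Λ') -
          (Ψ.localHamiltonian Λ' * fermionEmbed (PolySite.incl hΛ) C -
              fermionEmbed (PolySite.incl hΛ) C * Ψ.localHamiltonian Λ') *
            (fermionEmbed (PolySite.incl hΛ) C)ᴴ)).re := by
  classical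
  set Γ := fermionEmbed (PolySite.incl hΛ) with hΓ
  set H := Ψ.localHamiltonian Λ' with hHdef
  set z : ℂ := ω.expect Λ' (Γ C * Γ A - Γ A * Γ C) with hz
  set P : ℝ := (ω.expect Λ' (Γ A * (Γ A)ᴴ + (Γ A)ᴴ * Γ A)).re with hP
  set Q : ℝ := (ω.expect Λ' ((Γ C)ᴴ * (H * Γ C - Γ C * H) - (H * Γ C - Γ C * H) * (Γ C)ᴴ)).re with hQ
  -- the rows for `A ↦ μ • A`, `μ ∈ ℂ`: `0 ≤ |μ|² P + 2 Re(μ z) + ½β Q`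
  have hrow : ∀ μ : ℂ, 0 ≤ ‖μ‖ ^ 2 * P + 2 * (μ * z).re + β / 2 * Q := by
    intro μ
    have h1 := h hΛ h8 (μ • A) C
    have e1 : Γ (μ • A) * (Γ (μ • A))ᴴ + (Γ (μ • A))ᴴ * Γ (μ • A) = ((‖μ‖ ^ 2 : ℝ) : ℂ) • (Γ A * (Γ A)ᴴ + (Γ A)ᴴ * Γ A) := by
      simp only [map_smul, conjTranspose_smul, Complex.star_def, Matrix.smul_mul, Matrix.mul_smul, smul_smul]
      rw [Complex.mul_conj', Complex.conj_mul', ← smul_add, Complex.ofReal_pow]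
    have e2 : Γ C * Γ (μ • A) - Γ (μ • A) * Γ C = μ • (Γ C * Γ A - Γ A * Γ C) := by
      rw [map_smul, Matrix.mul_smul, Matrix.smul_mul, smul_sub]
    rw [← hΓ, ← hHdef, e1, e2, map_smul, map_smul, smul_eq_mul, smul_eq_mul, Complex.re_ofReal_mul, ← hz, ← hP, ← hQ] at h1
    exact h1
  have hP0 : 0 ≤ P := by
    have h1 : 0 ≤ (ω.expect Λ' (Γ A * (Γ A)ᴴ)).re := by
      have h2 := ω.expect_nonneg Λ' (Γ A)ᴴ
      rw [conjTranspose_conjTranspose] at h2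
      exact (Complex.nonneg_iff.1 h2).1
    have h2 : 0 ≤ (ω.expect Λ' ((Γ A)ᴴ * Γ A)).re := (Complex.nonneg_iff.1 (ω.expect_nonneg Λ' (Γ A))).1
    rw [hP, map_add, Complex.add_re]; exact add_nonneg h1 h2
  have hQ0 : 0 ≤ β / 2 * Q := by
    have h1 := hrow 0
    rwa [norm_zero, zero_pow two_ne_zero, zero_mul, zero_mul, Complex.zero_re, mul_zero, zero_add, zero_add] at h1
  -- the real quadratic `s ↦ ‖z‖²P s² − 2‖z‖² s + ½βQ ≥ 0` (`μ = −s z̄`) has nonpositive discriminant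
  have hquad : ∀ s : ℝ, 0 ≤ ‖z‖ ^ 2 * P * (s * s) + -(2 * ‖z‖ ^ 2) * s + β / 2 * Q := by
    intro s
    have h1 := hrow (-((s : ℂ) * (starRingEnd ℂ) z))
    have hn : ‖-((s : ℂ) * (starRingEnd ℂ) z)‖ ^ 2 = s ^ 2 * ‖z‖ ^ 2 := by
      rw [norm_neg, norm_mul, Complex.norm_real, Complex.norm_conj, mul_pow, Real.norm_eq_abs, sq_abs]
    have hre : (-((s : ℂ) * (starRingEnd ℂ) z) * z).re = -(s * ‖z‖ ^ 2) := by
      rw [neg_mul, Complex.neg_re, mul_assoc, Complex.conj_mul', ← Complex.ofReal_pow, ← Complex.ofReal_mul, Complex.ofReal_re]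
    rw [hn, hre] at h1
    have e : ‖z‖ ^ 2 * P * (s * s) + -(2 * ‖z‖ ^ 2) * s + β / 2 * Q = s ^ 2 * ‖z‖ ^ 2 * P + 2 * -(s * ‖z‖ ^ 2) + β / 2 * Q := by
      ring
    rw [e]; exact h1
  have hdisc := discrim_le_zero hquad
  rw [discrim] at hdisc
  show ‖z‖ ^ 2 ≤ β / 2 * P * Q
  rcases (sq_nonneg ‖z‖).eq_or_lt with hz0 | hzpos
  · rw [← hz0]
    have e : β / 2 * P * Q = P * (β / 2 * Q) := by ring
    rw [e]; exact mul_nonneg hP0 hQ0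
  · have hfin : ‖z‖ ^ 2 * ‖z‖ ^ 2 ≤ ‖z‖ ^ 2 * (β / 2 * P * Q) := by nlinarith [hdisc]
    exact le_of_mul_le_mul_left hfin hzpos

/-- The double commutator with the local Hamiltonian is affine along a pencil of interactions:
`C̃ᴴ[H₀ + sH₁, C̃] − [H₀ + sH₁, C̃]C̃ᴴ = (C̃ᴴ[H₀,C̃] − [H₀,C̃]C̃ᴴ) + s·(C̃ᴴ[H₁,C̃] − [H₁,C̃]C̃ᴴ)`. [cite: KomaTasaki1994, §1] -/
theorem doubleCommutator_pencil {Λ' : Finset (Site d)} (H₀ H₁ c : FermionOp Λ') (s : ℝ) :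
    cᴴ * ((H₀ + (s : ℂ) • H₁) * c - c * (H₀ + (s : ℂ) • H₁)) - ((H₀ + (s : ℂ) • H₁) * c - c * (H₀ + (s : ℂ) • H₁)) * cᴴ =
      (cᴴ * (H₀ * c - c * H₀) - (H₀ * c - c * H₀) * cᴴ) + (s : ℂ) • (cᴴ * (H₁ * c - c * H₁) - (H₁ * c - c * H₁) * cᴴ) := by
  simp only [Matrix.add_mul, Matrix.mul_add, Matrix.smul_mul, Matrix.mul_smul, Matrix.mul_sub, Matrix.sub_mul, smul_sub]
  module

/-- **THE BOGOLIUBOV ROWS ARE CLOSED UNDER LIMITS OF STATES ALONG A PENCIL OF INTERACTIONS**: if `ω_k` has the Bogoliubov rows of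
`Ψ₀ + s_kΨ₁` at `β_k` (range parameter `R`), `s_k → s`, `β_k → β`, and `ω_k → ω` on every local algebra, then `ω` has the Bogoliubov
rows of `Ψ₀ + sΨ₁` at `β` — each row is jointly continuous in `(ω, s, β)`, the double commutator being affine in `s`. The case
`Ψ₁ =` a symmetry-breaking source, `s_k → 0`: Koma–Tasaki's infinitesimal-field states inherit Bogoliubov's inequality for the
UNPERTURBED dynamics. [cite: KomaTasaki1993, §1 (1.8)] [cite: BratteliRobinsonII1997, Prop. 5.3.25] [cite: DLS1978, §2 eq. (28)] -/
theorem HasBogoliubovRows.of_tendsto_pencil {Ψ₀ Ψ₁ : FermionInteraction d} {R : ℝ} {ωk : ℕ → InfVolFermionState d}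
    {sk βk : ℕ → ℝ} {s β : ℝ} {ω : InfVolFermionState d}
    (hk : ∀ k, (ωk k).HasBogoliubovRows (FermionInteraction.pencil Ψ₀ Ψ₁ (sk k)) R (βk k))
    (hs : Tendsto sk atTop (𝓝 s)) (hβ : Tendsto βk atTop (𝓝 β))
    (hlim : ∀ (Λ : Finset (Site d)) (A : FermionOp Λ), Tendsto (fun k => (ωk k).expect Λ A) atTop (𝓝 (ω.expect Λ A))) :
    ω.HasBogoliubovRows (FermionInteraction.pencil Ψ₀ Ψ₁ s) R β := by
  intro Λ Λ' hΛ h8 A C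
  set a := fermionEmbed (PolySite.incl hΛ) A with ha
  set c := fermionEmbed (PolySite.incl hΛ) C with hc
  set D₀ : FermionOp Λ' := cᴴ * (Ψ₀.localHamiltonian Λ' * c - c * Ψ₀.localHamiltonian Λ') -
    (Ψ₀.localHamiltonian Λ' * c - c * Ψ₀.localHamiltonian Λ') * cᴴ with hD₀
  set D₁ : FermionOp Λ' := cᴴ * (Ψ₁.localHamiltonian Λ' * c - c * Ψ₁.localHamiltonian Λ') -
    (Ψ₁.localHamiltonian Λ' * c - c * Ψ₁.localHamiltonian Λ') * cᴴ with hD₁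
  rw [FermionInteraction.localHamiltonian_pencil, doubleCommutator_pencil, ← hD₀, ← hD₁]
  have hP : Tendsto (fun k => ((ωk k).expect Λ' (a * aᴴ + aᴴ * a)).re) atTop (𝓝 ((ω.expect Λ' (a * aᴴ + aᴴ * a)).re)) :=
    (Complex.continuous_re.tendsto _).comp (hlim Λ' _)
  have hX : Tendsto (fun k => ((ωk k).expect Λ' (c * a - a * c)).re) atTop (𝓝 ((ω.expect Λ' (c * a - a * c)).re)) :=
    (Complex.continuous_re.tendsto _).comp (hlim Λ' _)
  have hQ : Tendsto (fun k => ((ωk k).expect Λ' (D₀ + ((sk k : ℝ) : ℂ) • D₁)).re) atTop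
      (𝓝 ((ω.expect Λ' (D₀ + ((s : ℝ) : ℂ) • D₁)).re)) := by
    have hsC : Tendsto (fun k => ((sk k : ℝ) : ℂ)) atTop (𝓝 ((s : ℝ) : ℂ)) := (Complex.continuous_ofReal.tendsto s).comp hs
    simp_rw [map_add, map_smul, smul_eq_mul]
    exact (Complex.continuous_re.tendsto _).comp ((hlim Λ' D₀).add (hsC.mul (hlim Λ' D₁)))
  refine ge_of_tendsto ((hP.add (hX.const_mul 2)).add ((hβ.div_const 2).mul hQ)) (Eventually.of_forall fun k => ?_)
  have h1 := hk k hΛ h8 A C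
  rw [FermionInteraction.localHamiltonian_pencil, ← ha, ← hc, doubleCommutator_pencil, ← hD₀, ← hD₁] at h1
  exact h1

/-- **THE BOGOLIUBOV ROWS ARE WEAK⋆ CLOSED** (fixed interaction, `β_k → β`): local limits of states with the Bogoliubov rows of `Ψ`
at `β_k` have them at `β = lim β_k` (Bratteli–Robinson: the KMS states form a weak⋆-closed family, jointly in `β`).
[cite: BratteliRobinsonII1997, Thm. 5.3.30] [cite: DLS1978, §2 eq. (28)] -/
theorem HasBogoliubovRows.of_tendsto {Ψ : FermionInteraction d} {R : ℝ} {ωk : ℕ → InfVolFermionState d} {βk : ℕ → ℝ} {β : ℝ}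
    {ω : InfVolFermionState d} (hk : ∀ k, (ωk k).HasBogoliubovRows Ψ R (βk k)) (hβ : Tendsto βk atTop (𝓝 β))
    (hlim : ∀ (Λ : Finset (Site d)) (A : FermionOp Λ), Tendsto (fun k => (ωk k).expect Λ A) atTop (𝓝 (ω.expect Λ A))) :
    ω.HasBogoliubovRows Ψ R β := by
  have e : FermionInteraction.pencil Ψ Ψ 0 = Ψ := FermionInteraction.ext fun X => FermionInteraction.pencil_zero_apply Ψ Ψ X
  have h1 := HasBogoliubovRows.of_tendsto_pencil (Ψ₀ := Ψ) (Ψ₁ := Ψ) (sk := fun _ => (0 : ℝ)) (s := 0)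
    (fun k => by rw [e]; exact hk k) tendsto_const_nhds hβ hlim
  rwa [e] at h1

/-- **Translation-invariant solutions of the variational principle have the Bogoliubov rows** (the tree's
`IsTranslationInvariant.bogoliubovRow_nonneg_of_variationalPrinciple`). [cite: DLS1978, §2 eq. (28)] [cite: ArakiMoriya2003, Theorem 12.11] -/
theorem IsTranslationInvariant.hasBogoliubovRows_of_variationalPrinciple (hd : 0 < d) (hH : Ψ.IsHermitian) (hE : Ψ.IsEven)
    (hT : Ψ.IsTranslationInvariant) (hR : Ψ.HasFiniteRange R) (hβ : 0 ≤ β) (hω : ω.IsTranslationInvariant)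
    (hS : Tendsto (fun n : ℕ => vonNeumannEntropy (ω.rdm (halfOpenBox d n)) / ((n : ℝ) ^ d)) atTop
      (𝓝 (Ψ.freePressure β + β * ω.meanEnergy Ψ R))) :
    ω.HasBogoliubovRows Ψ R β :=
  fun _ _ _ h8 A C => hω.bogoliubovRow_nonneg_of_variationalPrinciple hd hH hE hT hR hβ hS h8 A C

/-- **Every translation-invariant equilibrium state has the Bogoliubov rows** (`IsVarEquilibrium.bogoliubovRow_nonneg`).
[cite: DLS1978, §2 eq. (28)] [cite: ArakiMoriya2003, Theorem 12.11] -/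
theorem IsVarEquilibrium.hasBogoliubovRows (hd : 0 < d) (hH : Ψ.IsHermitian) (hE : Ψ.IsEven) (hT : Ψ.IsTranslationInvariant)
    (hR : Ψ.HasFiniteRange R) (hβ : 0 ≤ β) (h : ω.IsVarEquilibrium β Ψ R) : ω.HasBogoliubovRows Ψ R β :=
  fun _ _ _ h8 A C => h.bogoliubovRow_nonneg hd hH hE hT hR hβ h8 A C

/-- **Every periodic equilibrium state has the Bogoliubov rows** (`IsPerVarEquilibrium.bogoliubovRow_nonneg`), every period `q`.
[cite: DLS1978, §2 eq. (28)] [cite: ArakiMoriya2003, Theorem 12.11] -/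
theorem IsPerVarEquilibrium.hasBogoliubovRows (hd : 0 < d) (hH : Ψ.IsHermitian) (hE : Ψ.IsEven) (hT : Ψ.IsTranslationInvariant)
    (hR : Ψ.HasFiniteRange R) (hβ : 0 ≤ β) {q : Fin d → ℕ} (h : ω.IsPerVarEquilibrium β q Ψ R) : ω.HasBogoliubovRows Ψ R β :=
  fun _ _ _ h8 A C => h.bogoliubovRow_nonneg hd hH hE hT hR hβ h8 A C

end Definition

/-! ### §2 The Klein–Landau–Shucker criterion for a state with Bogoliubov rows -/

section Criterion

variable {Ψ : FermionInteraction d} {R β : ℝ} {ω : InfVolFermionState d}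

/-- **QUANTITATIVE BOGOLIUBOV BOUND ON A CHARGED ONE-POINT FUNCTION, any state with Bogoliubov rows** (`β ≥ 0`): if `C ∈ 𝔄_{Λ₁}`
satisfies `C Õ − Õ C = κ Õ` (`Õ = Γ_{Λ⊆Λ₁}O`) then, for `Λ' ⊇ thicken Λ₁ R` and `C̃ = Γ_{Λ₁⊆Λ'}C`,
`|κ|² |ω(O)|² ≤ β ‖O‖² ‖C̃ᴴ(H_{Λ'}C̃ − C̃H_{Λ'}) − (H_{Λ'}C̃ − C̃H_{Λ'})C̃ᴴ‖` — Bogoliubov's inequality with `ω(ÕÕᴴ + ÕᴴÕ) ≤ 2‖O‖²`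
and the double commutator bounded by its norm. [cite: KleinLandauShucker1981] [cite: DLS1978, §2 eq. (28)] -/
theorem HasBogoliubovRows.norm_sq_expect_le_of_double_commutator (h : ω.HasBogoliubovRows Ψ R β) (hβ : 0 ≤ β)
    {Λ Λ₁ Λ' : Finset (Site d)} (h₁ : Λ ⊆ Λ₁) (hΛR : thicken Λ₁ R ⊆ Λ') (O : FermionOp Λ) {κ : ℂ} (C : FermionOp Λ₁)
    (hCO : C * fermionEmbed (PolySite.incl h₁) O - fermionEmbed (PolySite.incl h₁) O * C = κ • fermionEmbed (PolySite.incl h₁) O) :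
    ‖κ‖ ^ 2 * ‖ω.expect Λ O‖ ^ 2 ≤ β * ‖O‖ ^ 2 *
      ‖(fermionEmbed (PolySite.incl ((subset_thicken Λ₁ R).trans hΛR)) C)ᴴ *
            (Ψ.localHamiltonian Λ' * fermionEmbed (PolySite.incl ((subset_thicken Λ₁ R).trans hΛR)) C -
              fermionEmbed (PolySite.incl ((subset_thicken Λ₁ R).trans hΛR)) C * Ψ.localHamiltonian Λ') -
          (Ψ.localHamiltonian Λ' * fermionEmbed (PolySite.incl ((subset_thicken Λ₁ R).trans hΛR)) C -
              fermionEmbed (PolySite.incl ((subset_thicken Λ₁ R).trans hΛR)) C * Ψ.localHamiltonian Λ') *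
            (fermionEmbed (PolySite.incl ((subset_thicken Λ₁ R).trans hΛR)) C)ᴴ‖ := by
  set Γ' := fermionEmbed (PolySite.incl ((subset_thicken Λ₁ R).trans hΛR)) with hΓ'
  set H := Ψ.localHamiltonian Λ' with hHdef
  set O₁ := fermionEmbed (PolySite.incl h₁) O with hO₁
  set D := (Γ' C)ᴴ * (H * Γ' C - Γ' C * H) - (H * Γ' C - Γ' C * H) * (Γ' C)ᴴ with hD
  have hB := h.bogoliubov_inequality ((subset_thicken Λ₁ R).trans hΛR) hΛR O₁ C
  rw [← hΓ', ← hHdef] at hB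
  have hcomm : Γ' C * Γ' O₁ - Γ' O₁ * Γ' C = κ • Γ' O₁ := by
    rw [← map_mul, ← map_mul, ← map_sub, hCO, map_smul]
  have hωO : ω.expect Λ' (Γ' O₁) = ω.expect Λ O := by
    rw [hΓ', hO₁, fermionEmbed_incl_fermionEmbed_incl]
    exact ω.compatible _ O
  rw [hcomm, map_smul, smul_eq_mul, hωO, norm_mul, mul_pow] at hB
  have hP : (ω.expect Λ' (Γ' O₁ * (Γ' O₁)ᴴ + (Γ' O₁)ᴴ * Γ' O₁)).re ≤ 2 * ‖O‖ ^ 2 := by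
    have hn : ‖Γ' O₁‖ ≤ ‖O‖ := (norm_fermionEmbed_le _ _).trans (norm_fermionEmbed_le _ _)
    have h1 : (ω.expect Λ' (Γ' O₁ * (Γ' O₁)ᴴ + (Γ' O₁)ᴴ * Γ' O₁)).re ≤ ‖Γ' O₁ * (Γ' O₁)ᴴ + (Γ' O₁)ᴴ * Γ' O₁‖ :=
      (Complex.re_le_norm _).trans (ω.norm_expect_le Λ' _)
    have h2 : ‖Γ' O₁ * (Γ' O₁)ᴴ + (Γ' O₁)ᴴ * Γ' O₁‖ ≤ ‖Γ' O₁‖ * ‖Γ' O₁‖ + ‖Γ' O₁‖ * ‖Γ' O₁‖ := by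
      refine (norm_add_le _ _).trans (add_le_add ?_ ?_)
      · exact (norm_mul_le _ _).trans (by rw [Matrix.l2_opNorm_conjTranspose])
      · exact (norm_mul_le _ _).trans (by rw [Matrix.l2_opNorm_conjTranspose])
    have h3 : ‖Γ' O₁‖ * ‖Γ' O₁‖ ≤ ‖O‖ * ‖O‖ := mul_le_mul hn hn (norm_nonneg _) (norm_nonneg _)
    nlinarith
  have hP0 : 0 ≤ (ω.expect Λ' (Γ' O₁ * (Γ' O₁)ᴴ + (Γ' O₁)ᴴ * Γ' O₁)).re := by
    have ha : 0 ≤ (ω.expect Λ' (Γ' O₁ * (Γ' O₁)ᴴ)).re := by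
      have h' := ω.expect_nonneg Λ' (Γ' O₁)ᴴ
      rw [conjTranspose_conjTranspose] at h'
      exact (Complex.nonneg_iff.1 h').1
    have hb : 0 ≤ (ω.expect Λ' ((Γ' O₁)ᴴ * Γ' O₁)).re := (Complex.nonneg_iff.1 (ω.expect_nonneg Λ' (Γ' O₁))).1
    rw [map_add, Complex.add_re]; exact add_nonneg ha hb
  have hQ : (ω.expect Λ' D).re ≤ ‖D‖ := (Complex.re_le_norm _).trans (ω.norm_expect_le Λ' _)
  have hβP : 0 ≤ β / 2 * (ω.expect Λ' (Γ' O₁ * (Γ' O₁)ᴴ + (Γ' O₁)ᴴ * Γ' O₁)).re := mul_nonneg (by positivity) hP0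
  calc ‖κ‖ ^ 2 * ‖ω.expect Λ O‖ ^ 2
      ≤ β / 2 * (ω.expect Λ' (Γ' O₁ * (Γ' O₁)ᴴ + (Γ' O₁)ᴴ * Γ' O₁)).re * (ω.expect Λ' D).re := hB
    _ ≤ β / 2 * (ω.expect Λ' (Γ' O₁ * (Γ' O₁)ᴴ + (Γ' O₁)ᴴ * Γ' O₁)).re * ‖D‖ := mul_le_mul_of_nonneg_left hQ hβP
    _ ≤ β / 2 * (2 * ‖O‖ ^ 2) * ‖D‖ := by
        refine mul_le_mul_of_nonneg_right (mul_le_mul_of_nonneg_left hP (by positivity)) (norm_nonneg _)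
    _ = β * ‖O‖ ^ 2 * ‖D‖ := by ring

/-- **THE MERMIN–WAGNER CRITERION FOR A STATE WITH BOGOLIUBOV ROWS** (Klein–Landau–Shucker's use of Bogoliubov's inequality): let
`O ∈ 𝔄_Λ` and `κ ≠ 0`. Suppose that for every `ε > 0` there are regions `Λ ⊆ Λ₁`, `thicken Λ₁ R ⊆ Λ'` and `C ∈ 𝔄_{Λ₁}` with
`C Õ − Õ C = κ Õ` and `‖C̃ᴴ(H_{Λ'}C̃ − C̃H_{Λ'}) − (H_{Λ'}C̃ − C̃H_{Λ'})C̃ᴴ‖ ≤ ε`. Then `ω(O) = 0`.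
[cite: KleinLandauShucker1981] [cite: DLS1978, §2 eq. (28)] [cite: ArakiMoriya2003, Theorem 12.11] -/
theorem HasBogoliubovRows.expect_eq_zero_of_small_double_commutators (h : ω.HasBogoliubovRows Ψ R β) (hβ : 0 ≤ β)
    {Λ : Finset (Site d)} (O : FermionOp Λ) {κ : ℂ} (hκ : κ ≠ 0)
    (hgen : ∀ ε : ℝ, 0 < ε → ∃ (Λ₁ : Finset (Site d)) (h₁ : Λ ⊆ Λ₁) (Λ' : Finset (Site d)) (hΛR : thicken Λ₁ R ⊆ Λ')
      (C : FermionOp Λ₁),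
        C * fermionEmbed (PolySite.incl h₁) O - fermionEmbed (PolySite.incl h₁) O * C = κ • fermionEmbed (PolySite.incl h₁) O ∧
        ‖(fermionEmbed (PolySite.incl ((subset_thicken Λ₁ R).trans hΛR)) C)ᴴ *
              (Ψ.localHamiltonian Λ' * fermionEmbed (PolySite.incl ((subset_thicken Λ₁ R).trans hΛR)) C -
                fermionEmbed (PolySite.incl ((subset_thicken Λ₁ R).trans hΛR)) C * Ψ.localHamiltonian Λ') -
            (Ψ.localHamiltonian Λ' * fermionEmbed (PolySite.incl ((subset_thicken Λ₁ R).trans hΛR)) C -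
                fermionEmbed (PolySite.incl ((subset_thicken Λ₁ R).trans hΛR)) C * Ψ.localHamiltonian Λ') *
              (fermionEmbed (PolySite.incl ((subset_thicken Λ₁ R).trans hΛR)) C)ᴴ‖ ≤ ε) :
    ω.expect Λ O = 0 := by
  have key : ∀ ε : ℝ, 0 < ε → ‖κ‖ ^ 2 * ‖ω.expect Λ O‖ ^ 2 ≤ β * ‖O‖ ^ 2 * ε := by
    intro ε hε
    obtain ⟨Λ₁, h₁, Λ', hΛR, C, hCO, hD⟩ := hgen ε hε
    exact (h.norm_sq_expect_le_of_double_commutator hβ h₁ hΛR O C hCO).trans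
      (mul_le_mul_of_nonneg_left hD (by positivity))
  have h0 : ‖κ‖ ^ 2 * ‖ω.expect Λ O‖ ^ 2 ≤ 0 := by
    by_contra h'
    rw [not_le] at h'
    set X := ‖κ‖ ^ 2 * ‖ω.expect Λ O‖ ^ 2 with hX
    set K := β * ‖O‖ ^ 2 with hK
    have hK0 : 0 ≤ K := by positivity
    have h1 := key (X / (2 * (K + 1))) (by positivity)
    have h2 : K * (X / (2 * (K + 1))) ≤ (K + 1) * (X / (2 * (K + 1))) :=
      mul_le_mul_of_nonneg_right (by linarith) (by positivity)
    have h3 : (K + 1) * (X / (2 * (K + 1))) = X / 2 := by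
      field_simp
    linarith
  have hκ2 : 0 < ‖κ‖ ^ 2 := by positivity
  have h1 : ‖ω.expect Λ O‖ ^ 2 ≤ 0 := by
    by_contra h'; rw [not_le] at h'; nlinarith
  have h2 : ‖ω.expect Λ O‖ = 0 := by nlinarith [norm_nonneg (ω.expect Λ O), sq_nonneg ‖ω.expect Λ O‖]
  exact norm_eq_zero.1 h2

/-- **QUANTITATIVE ORDER-PARAMETER BOUND FOR A CONSERVED ON-SITE CHARGE, any state with Bogoliubov rows**: with `q` even Hermitian
and conserved term by term (`Q_Z Φ(Z) = Φ(Z) Q_Z`), `O` of charge `κ` (`Q_Λ O − O Q_Λ = κO`), ANY region `Λ₁ ⊇ Λ`, real weights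
`f ≡ 1` on `Λ`, `f ≡ 0` off `Λ₁` and any constants `c_Z`:
`|κ|²|ω(O)|² ≤ β‖O‖² · 4‖q‖² Σ_{Z ⊆ thicken Λ₁ R} ‖Φ(Z)‖ (Σ_{x∈Z}|f(x) − c_Z|)²`. [cite: KleinLandauShucker1981] [cite: DLS1978, §2 eq. (28)] -/
theorem HasBogoliubovRows.norm_sq_expect_le_of_conservedCharge (h : ω.HasBogoliubovRows Ψ R β) (hβ : 0 ≤ β)
    {q : FermionOp ({0} : Finset (Site d))} (hq : q.IsHermitian) (hqe : parityAut q = q)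
    (hcons : ∀ Z : Finset (Site d), Commute (chargeSum q Z) (Ψ.Φ Z))
    {Λ : Finset (Site d)} (O : FermionOp Λ) {κ : ℂ} (hO : chargeSum q Λ * O - O * chargeSum q Λ = κ • O)
    {Λ₁ : Finset (Site d)} (h₁ : Λ ⊆ Λ₁) {f : Site d → ℝ} (hf1 : ∀ x ∈ Λ, f x = 1) (hf0 : ∀ x ∉ Λ₁, f x = 0)
    (c : Finset (Site d) → ℝ) :
    ‖κ‖ ^ 2 * ‖ω.expect Λ O‖ ^ 2 ≤ β * ‖O‖ ^ 2 *
      (4 * ‖q‖ ^ 2 * ∑ Z ∈ (thicken Λ₁ R).powerset, ‖Ψ.Φ Z‖ * (∑ x ∈ Z, |f x - c Z|) ^ 2) := by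
  have hCO : weightedCharge q f Λ₁ * fermionEmbed (PolySite.incl h₁) O - fermionEmbed (PolySite.incl h₁) O * weightedCharge q f Λ₁ =
      κ • fermionEmbed (PolySite.incl h₁) O := by
    rw [weightedCharge_commutator_fermionEmbed hqe h₁ hf1 O, hO, map_smul]
  refine (h.norm_sq_expect_le_of_double_commutator hβ h₁ le_rfl O (weightedCharge q f Λ₁) hCO).trans ?_
  refine mul_le_mul_of_nonneg_left ?_ (by positivity)
  have hW : fermionEmbed (PolySite.incl ((subset_thicken Λ₁ R).trans le_rfl)) (weightedCharge q f Λ₁) =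
      weightedCharge q f (thicken Λ₁ R) :=
    fermionEmbed_incl_weightedCharge _ fun x _ hx => hf0 x hx
  rw [hW, conjTranspose_weightedCharge hq]
  exact norm_doubleCommutator_weightedCharge_localHamiltonian_le hqe hcons _ f c

/-- **MERMIN–WAGNER CRITERION FOR A CONSERVED ON-SITE CHARGE, any state with Bogoliubov rows.** Let `Ψ` be translation covariant
of finite range `R`, `q ∈ 𝔄_{{0}}` even and Hermitian, conserved by every term of `Ψ`, and `O ∈ 𝔄_Λ` of charge `κ ≠ 0`. If for every
`ε > 0` there are `Λ₁ ⊇ Λ`, weights `f ≡ 1` on `Λ`, `f ≡ 0` off `Λ₁`, and a modulus `b` with `|f(x) − f(y)| ≤ b(x)` for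
`‖y − x‖_∞ ≤ R` and `4‖q‖² |box ⌊R⌋| S_Ψ Σ_{x ∈ thicken Λ₁ R} b(x)² ≤ ε`, then `ω(O) = 0` for every state `ω` with the Bogoliubov rows
of `Ψ` at `β ≥ 0`. [cite: KleinLandauShucker1981] [cite: ArakiMoriya2003, Theorem 12.11] -/
theorem HasBogoliubovRows.expect_eq_zero_of_conservedCharge (h : ω.HasBogoliubovRows Ψ R β) (hβ : 0 ≤ β)
    (hT : Ψ.IsTranslationInvariant) (hR : Ψ.HasFiniteRange R)
    {q : FermionOp ({0} : Finset (Site d))} (hq : q.IsHermitian) (hqe : parityAut q = q)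
    (hcons : ∀ Z : Finset (Site d), Commute (chargeSum q Z) (Ψ.Φ Z))
    {Λ : Finset (Site d)} (O : FermionOp Λ) {κ : ℂ} (hκ : κ ≠ 0) (hO : chargeSum q Λ * O - O * chargeSum q Λ = κ • O)
    (hf : ∀ ε : ℝ, 0 < ε → ∃ (Λ₁ : Finset (Site d)) (_ : Λ ⊆ Λ₁) (f b : Site d → ℝ),
      (∀ x ∈ Λ, f x = 1) ∧ (∀ x ∉ Λ₁, f x = 0) ∧ (∀ x y : Site d, y - x ∈ box d ⌊R⌋₊ → |f x - f y| ≤ b x) ∧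
      4 * ‖q‖ ^ 2 * (((box d ⌊R⌋₊).card : ℝ) * (∑ X ∈ (thicken ({0} : Finset (Site d)) R).powerset with (0 : Site d) ∈ X, ‖Ψ.Φ X‖) *
        ∑ x ∈ thicken Λ₁ R, b x ^ 2) ≤ ε) :
    ω.expect Λ O = 0 := by
  refine h.expect_eq_zero_of_small_double_commutators hβ O hκ fun ε hε => ?_
  obtain ⟨Λ₁, h₁, f, b, hf1, hf0, hb, hε'⟩ := hf ε hε
  refine ⟨Λ₁, h₁, thicken Λ₁ R, le_rfl, weightedCharge q f Λ₁, ?_, ?_⟩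
  · rw [weightedCharge_commutator_fermionEmbed hqe h₁ hf1 O, hO, map_smul]
  · have hW : fermionEmbed (PolySite.incl ((subset_thicken Λ₁ R).trans le_rfl)) (weightedCharge q f Λ₁) =
        weightedCharge q f (thicken Λ₁ R) :=
      fermionEmbed_incl_weightedCharge _ fun x _ hx => hf0 x hx
    rw [hW, conjTranspose_weightedCharge hq]
    obtain ⟨c, hc⟩ := Ψ.sum_norm_mul_sq_sum_le hT hR (thicken Λ₁ R) hb
    refine (norm_doubleCommutator_weightedCharge_localHamiltonian_le hqe hcons _ f c).trans (le_trans ?_ hε')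
    exact mul_le_mul_of_nonneg_left hc (by positivity)

end Criterion

/-! ### §3 Two dimensions: every state with Bogoliubov rows is invariant under the conserved continuous symmetry -/

section TwoD

variable {Ψ : FermionInteraction 2} {R β : ℝ} {ω : InfVolFermionState 2}

/-- **MERMIN–WAGNER IN TWO DIMENSIONS FOR EVERY STATE WITH BOGOLIUBOV ROWS (Klein–Landau–Shucker).** Let `Ψ` be a translation-covariant
interaction of finite range `R` on `ℤ²` each of whose terms conserves the even Hermitian on-site charge `q` (`Q_Z Φ(Z) = Φ(Z) Q_Z`), `β ≥ 0`,
and `ω` ANY state with the Bogoliubov rows of `Ψ` at `β` — no translation invariance, periodicity or extremality assumed. Then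
`ω(O) = 0` for every local `O ∈ 𝔄_Λ` of nonzero charge (`Q_Λ O − O Q_Λ = κO`, `κ ≠ 0`): Bogoliubov's inequality with the smeared
generator `Σ_x f(x)q_x`, `f` the logarithmic cutoff (`exists_logCutoff_data`). [cite: KleinLandauShucker1981] [cite: ArakiMoriya2003, Theorem 12.11] -/
theorem HasBogoliubovRows.expect_eq_zero_of_conservedCharge_two (h : ω.HasBogoliubovRows Ψ R β) (hβ : 0 ≤ β)
    (hT : Ψ.IsTranslationInvariant) (hR : Ψ.HasFiniteRange R)
    {q : FermionOp ({0} : Finset (Site 2))} (hq : q.IsHermitian) (hqe : parityAut q = q)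
    (hcons : ∀ Z : Finset (Site 2), Commute (chargeSum q Z) (Ψ.Φ Z))
    {Λ : Finset (Site 2)} (O : FermionOp Λ) {κ : ℂ} (hκ : κ ≠ 0) (hO : chargeSum q Λ * O - O * chargeSum q Λ = κ • O) :
    ω.expect Λ O = 0 := by
  refine h.expect_eq_zero_of_conservedCharge hβ hT hR hq hqe hcons O hκ hO fun ε hε => ?_
  obtain ⟨Λ₁, h₁, f, b, hf1, hf0, hb, hsum⟩ := exists_logCutoff_data Λ R
    (K := 4 * ‖q‖ ^ 2 * (((box 2 ⌊R⌋₊).card : ℝ) *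
      ∑ X ∈ (thicken ({0} : Finset (Site 2)) R).powerset with (0 : Site 2) ∈ X, ‖Ψ.Φ X‖)) (by positivity) hε
  refine ⟨Λ₁, h₁, f, b, hf1, hf0, hb, ?_⟩
  calc _ = 4 * ‖q‖ ^ 2 * (((box 2 ⌊R⌋₊).card : ℝ) *
        ∑ X ∈ (thicken ({0} : Finset (Site 2)) R).powerset with (0 : Site 2) ∈ X, ‖Ψ.Φ X‖) * ∑ x ∈ thicken Λ₁ R, b x ^ 2 := by ring
    _ ≤ ε := hsum

end TwoD

/-! ### §4 The two-dimensional `t–t'` Hubbard model: no `U(1)` or `S^z`-rotation breaking in ANY state with Bogoliubov rows -/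

section Hubbard

variable (t t' U μ hz : ℝ) {β : ℝ} (hβ : 0 ≤ β) {ω : InfVolFermionState 2}
include hβ

/-- **MERMIN–WAGNER FOR THE 2D `t–t'` HUBBARD MODEL, any state with Bogoliubov rows, particle number**: for every `β ≥ 0`, every
state `ω` with the Bogoliubov rows of `gcInteractionTT' t t' U μ h` (range `1`) at `β` and every local `O ∈ 𝔄_Λ` with
`N_Λ O − O N_Λ = κO`, `κ ≠ 0`: `ω(O) = 0`. [cite: KleinLandauShucker1981] [cite: KomaTasakiPRL1992, p. 3] -/
theorem HasBogoliubovRows.expect_eq_zero_of_numberCharged_ttPrime (h : ω.HasBogoliubovRows (gcInteractionTT' t t' U μ hz) 1 β)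
    {Λ : Finset (Site 2)} (O : FermionOp Λ) {κ : ℂ} (hκ : κ ≠ 0)
    (hO : (totalNumber : FermionOp Λ) * O - O * totalNumber = κ • O) : ω.expect Λ O = 0 :=
  h.expect_eq_zero_of_conservedCharge_two hβ (gcInteractionTT'_isTranslationInvariant t t' U μ hz)
    (gcInteractionTT'_hasFiniteRange t t' U μ hz) (numberCharge_isHermitian 2) (parityAut_numberCharge 2)
    (commute_chargeSum_numberCharge_gcInteractionTT' t t' U μ hz) O hκ (by rw [chargeSum_numberCharge]; exact hO)

/-- **… spin rotations about `z`**: `ω(O) = 0` for every local `O` with `(N↑_Λ − N↓_Λ) O − O (N↑_Λ − N↓_Λ) = κO`, `κ ≠ 0` (e.g. `S^±_x`,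
`c_{x↑}c_{y↑}`), in every state with the Bogoliubov rows of the 2D `t–t'` Hubbard model at `β ≥ 0`. [cite: KleinLandauShucker1981]
[cite: KomaTasakiPRL1992, p. 3] -/
theorem HasBogoliubovRows.expect_eq_zero_of_spinCharged_ttPrime (h : ω.HasBogoliubovRows (gcInteractionTT' t t' U μ hz) 1 β)
    {Λ : Finset (Site 2)} (O : FermionOp Λ) {κ : ℂ} (hκ : κ ≠ 0)
    (hO : (spinImbalance : FermionOp Λ) * O - O * spinImbalance = κ • O) : ω.expect Λ O = 0 :=
  h.expect_eq_zero_of_conservedCharge_two hβ (gcInteractionTT'_isTranslationInvariant t t' U μ hz)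
    (gcInteractionTT'_hasFiniteRange t t' U μ hz) (spinCharge_isHermitian 2) (parityAut_spinCharge 2)
    (commute_chargeSum_spinCharge_gcInteractionTT' t t' U μ hz) O hκ (by rw [chargeSum_spinCharge]; exact hO)

/-- **NO PAIRING AMPLITUDE IN ANY STATE WITH BOGOLIUBOV ROWS OF THE 2D `t–t'` HUBBARD MODEL, AT ANY `β ≥ 0`**: `ω(c_p c_q) = 0` for all
orbitals `p, q` of every finite region (`N c_p c_q − c_p c_q N = −2 c_p c_q`). [cite: KleinLandauShucker1981] [cite: KomaTasakiPRL1992, p. 3] -/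
theorem HasBogoliubovRows.expect_annihilation_mul_annihilation_eq_zero_ttPrime
    (h : ω.HasBogoliubovRows (gcInteractionTT' t t' U μ hz) 1 β) {Λ : Finset (Site 2)} (p q : Orb (PolySite Λ)) :
    ω.expect Λ (annihilation p * annihilation q) = 0 :=
  h.expect_eq_zero_of_numberCharged_ttPrime t t' U μ hz hβ _ (by norm_num : (-2 : ℂ) ≠ 0)
    (totalNumber_commutator_annihilation_mul_annihilation p q)

/-- **NO LOCAL SINGLET-PAIR AMPLITUDE**: `ω(P_x) = 0` for the local pair `P_x = Σ_{e∈S} g(e)(c_{x↑}c_{x+e↓} − c_{x↓}c_{x+e↑})` of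
every stencil `S`, form factor `g` and site `x` (charge `−2`, `hasGaugeCharge_localPairAt`) — in particular for the `d`-wave pair
`g = dWaveFormFactor` — in every state with the Bogoliubov rows of the 2D `t–t'` Hubbard model at `β ≥ 0`.
[cite: KleinLandauShucker1981] [cite: KomaTasakiPRL1992, p. 3] -/
theorem HasBogoliubovRows.expect_localPairAt_eq_zero_ttPrime (h : ω.HasBogoliubovRows (gcInteractionTT' t t' U μ hz) 1 β)
    (S : Finset (Site 2)) (g : Site 2 → ℝ) (x : Site 2) : ω.expect (pairRegion S x) (localPairAt S g x) = 0 := by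
  refine h.expect_eq_zero_of_numberCharged_ttPrime t t' U μ hz hβ _ (by norm_num : ((-2 : ℤ) : ℂ) ≠ 0) ?_
  rw [← totalNumberOp_eq_totalNumber]
  exact hasGaugeCharge_iff_commutator.1 (hasGaugeCharge_localPairAt S g x)

/-- **EVERY STATE WITH THE BOGOLIUBOV ROWS OF THE 2D `t–t'` HUBBARD MODEL AT `β ≥ 0` IS GAUGE INVARIANT** (`ω ∘ γ_θ = ω` for all
`θ`): `ω([N̂_Λ, A]) = 0` for every local `A`, because `[N̂_Λ, A] = Σ_{s,t} (|s| − |t|) A_{st}|s⟩⟨t|` is a combination of matrix units of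
nonzero charge, each annihilated by `ω` (§4), and gauge invariance is equivalent to these linear constraints
(`isGaugeInvariant_of_forall_expect_commutator`). The `U(1)` symmetry of the 2D Hubbard model is unbroken at `T > 0` in every such
state. [cite: KleinLandauShucker1981] [cite: BratteliRobinsonII1997, §5.2.2] -/
theorem HasBogoliubovRows.isGaugeInvariant_ttPrime (h : ω.HasBogoliubovRows (gcInteractionTT' t t' U μ hz) 1 β) :
    ω.IsGaugeInvariant := by
  refine isGaugeInvariant_of_forall_expect_commutator fun Λ A => ?_
  have hdec : (totalNumberOp : FermionOp Λ) * A - A * (totalNumberOp : FermionOp Λ) =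
      ∑ s, ∑ u, ((((s.card : ℤ) - u.card : ℤ)) : ℂ) • Matrix.single s u (A s u) := by
    conv_lhs => rw [Matrix.matrix_eq_sum_single A]
    rw [Matrix.mul_sum, Matrix.sum_mul, ← Finset.sum_sub_distrib]
    refine Finset.sum_congr rfl fun s _ => ?_
    rw [Matrix.mul_sum, Matrix.sum_mul, ← Finset.sum_sub_distrib]
    refine Finset.sum_congr rfl fun u _ => ?_
    exact hasGaugeCharge_iff_commutator.1 (hasGaugeCharge_single s u (A s u))
  rw [hdec, map_sum]
  refine Finset.sum_eq_zero fun s _ => ?_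
  rw [map_sum]
  refine Finset.sum_eq_zero fun u _ => ?_
  rw [map_smul, smul_eq_mul]
  by_cases hsu : ((s.card : ℤ) - u.card : ℤ) = 0
  · rw [hsu, Int.cast_zero, zero_mul]
  · have hO : (totalNumber : FermionOp Λ) * Matrix.single s u (A s u) - Matrix.single s u (A s u) * totalNumber =
        ((((s.card : ℤ) - u.card : ℤ)) : ℂ) • Matrix.single s u (A s u) := by
      rw [← totalNumberOp_eq_totalNumber]
      exact hasGaugeCharge_iff_commutator.1 (hasGaugeCharge_single s u (A s u))
    rw [h.expect_eq_zero_of_numberCharged_ttPrime t t' U μ hz hβ _ (by exact_mod_cast hsu) hO, mul_zero]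

end Hubbard

end InfVolFermionState

end Literature.MathematicalPhysics.QuantumLattice

end
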